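import Summits.KontsevichZagierPeriods.KontsevichZagierPeriods.Theses.FermatIsogeny
import Summits.KontsevichZagierPeriods.KontsevichZagierPeriods.Theorems.SymplecticScissorsRealOnePeriodRelationsIsoLayer
import Summits.KontsevichZagierPeriods.KontsevichZagierPeriods.Theorems.RealOnePeriodRelations.Negative.Kit
import Summits.KontsevichZagierPeriods.KontsevichZagierPeriods.Theorems.RealOnePeriodRelations.Negative.GreenSound
import Summits.KontsevichZagierPeriods.KontsevichZagierPeriods.Theorems.FermatIsogenyBetaLinearSectorSplit
import Literature.NumberTheory.Transcendental.CurvePeriods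
import Literature.NumberTheory.Transcendental.CurvePeriodsGmLoopsProofs
import Literature.NumberTheory.Transcendental.KZCalculus

/-!
# `BetaLinearSector` (stmt-KontsevichZagierPeriods-3897) — THE FERMAT LAYER, implication-shaped (line `fermat-sector-transport`)

Crux (route FermatIsogeny, rank 3): for positive rationals `a b a' b'` and a real algebraic `c`, two one-dimensional
Kontsevich–Zagier representations pinned on `(0,1)` as `[t^{a-1}(1-t)^{b-1}]` and `[c·t^{a'-1}(1-t)^{b'-1}]` with the same value
are KZ-equivalent.

This support file is the lead's registered skeleton of line `fermat-sector-transport` with every registered stub turned into an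
explicit HYPOTHESIS (so that it is sorry-free and lands now; as the stubs land, the hypotheses are discharged by name):

* `SigD` (= stub `stub_fermatSymbolData`): the affine Fermat curve `F_N = {x^N + y^N = 1} ⊂ ℂ²` is a smooth affine curve over `ℚ̄`
  and its radial arc `γ_N(t) = Q(t)^{−1/N}·(1−t, t)`, `Q(t) = (1−t)^N + t^N`, is a `C¹` path with algebraic end points whose
  realification is `ℚ`-semialgebraic on `[0,1]`;
* `SigI` (= stub `stub_fermatIntegrand`): along `γ_N`, Rohrlich's polynomial form `ω_{r,s} = x^{r-1}y^{s-1}(y dx − x dy)` pulls back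
  to `−(1−t)^{r−1}t^{s−1}Q^{−(r+s)/N} dt`;
* `SigR` (= stub `stub_fermatRealise`): the rule-2 move `τ = (1−u)^N/Q(u)` carries the beta cell `[c·τ^{r/N−1}(1−τ)^{s/N−1}]` to the
  bounded arc representation `[cN(1−u)^{r−1}u^{s−1}Q^{−(r+s)/N}]` modulo `M₁`;
* `HWFermatArcs` (resp. `HWFermat`): Huber–Wüstholz 2022 Thm 13.3 (2) for `ℚ̄`-combinations of Fermat BETA-ARC symbols
  `(F_N, ω_{r,s}, γ_N)` — the Wolfart–Wüstholz 1985 setting (resp. of all symbols on affine Fermat curves); both implied by the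
  named fact `HuberWustholzCurvePeriods` (`huberWustholzFermatArcs_of_huberWustholzCurvePeriods`);
* Green: `greenSet ⊆ KZ.relations` (the four Green stubs of the line).

Results: `betaCells` (bookkeeping, unconditional), `betaArcs_of` (the `harcs` input of the landed
`SectorGlue.realOnePeriodRelations_of_sector` for beta cells, from `SigD`, `SigI`, `SigR` and the landed real realisation
`stub_realises`), `fermatLayer_of` (**the Fermat layer**: from `SigD SigI SigR HWFermatArcs`, every `ℤ`-combination of beta cells with
vanishing value lies in `M₁`), `betaLinearSector_of_fermatLayer` (layer + Green ⇒ crux) and `BetaLinearSector_of_fermatStubs`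
(registered anchor: all five hypotheses ⇒ the crux, by name).  All CONDITIONAL; nothing is credited until the stubs land.

References: A. Huber, G. Wüstholz, *Transcendence and linear relations of 1-periods* (2022), Thm 13.3 (2), §3.3.1, Cor. 12.7;
B. Gross (with an appendix by D. Rohrlich), *On the periods of abelian integrals and a formula of Chowla and Selberg*, Invent.
Math. 45 (1978), §1; M. Kontsevich, D. Zagier, *Periods* (2001), §1.2.
-/

noncomputable section

namespace Summit.KontsevichZagierPeriods.FermatIsogeny.BetaLinearSector

open scoped BigOperators
open MeasureTheory Set MvPolynomial
open Literature.NumberTheory.Transcendental Literature.NumberTheory.Transcendental.CurvePeriods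
open Literature.ModelTheory.ExponentialFields (IsSemialgebraic)
open Summit.KontsevichZagierPeriods.SymplecticScissors.RealOnePeriodRelationsNegative (greenSet M₁ H₁ crux_iff)
open Summit.KontsevichZagierPeriods.SymplecticScissors.RealOnePeriodRelations (Cells.combo_add Cells.combo_neg
  Cells.combo_single stub_realises)
open Summit.KontsevichZagierPeriods.KontsevichZagierPeriods.Theses.FermatIsogeny (BetaLinearSector)

-- Statement of the registered stub `stub_fermatSymbolData` (symbol data of the Fermat layer).
set_option quotPrecheck false in
local notation "SigD" =>
  (∀ N : ℕ, 1 ≤ N →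
    (⟨2, 1, ![X 0 ^ N + X 1 ^ N - 1]⟩ : CurveData).IsSmoothAffineCurve ∧
    ∃ γ : CurvePath (⟨2, 1, ![X 0 ^ N + X 1 ^ N - 1]⟩ : CurveData),
      (∀ t : ℝ, γ.toFun t = ![(((1 - t) * ((1 - t) ^ N + t ^ N) ^ (-(1:ℝ) / N) : ℝ) : ℂ),
        ((t * ((1 - t) ^ N + t ^ N) ^ (-(1:ℝ) / N) : ℝ) : ℂ)]) ∧
      IsSemialgebraicMapOn ℚ {z : Fin 1 → ℝ | z 0 ∈ Set.Icc (0 : ℝ) 1}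
        (fun z => Fin.append (fun i => (γ.toFun (z 0) i).re) (fun i => (γ.toFun (z 0) i).im)))

-- Statement of the registered stub `stub_fermatIntegrand` (the pulled-back form along the radial arc).
set_option quotPrecheck false in
local notation "SigI" =>
  (∀ (N r s : ℕ), 1 ≤ N → 1 ≤ r → 1 ≤ s →
    ∀ γ : CurvePath (⟨2, 1, ![X 0 ^ N + X 1 ^ N - 1]⟩ : CurveData),
    (∀ t : ℝ, γ.toFun t = ![(((1 - t) * ((1 - t) ^ N + t ^ N) ^ (-(1:ℝ) / N) : ℝ) : ℂ),
        ((t * ((1 - t) ^ N + t ^ N) ^ (-(1:ℝ) / N) : ℝ) : ℂ)]) →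
    ∀ t ∈ Set.Ioo (0:ℝ) 1,
      (∑ i, MvPolynomial.eval (γ.toFun t)
          ((![X 0 ^ (r - 1) * X 1 ^ s, -(X 0 ^ r * X 1 ^ (s - 1))] : Fin 2 → MvPolynomial (Fin 2) ℂ) i) *
        deriv (fun u => γ.toFun u i) t) =
      ((-((1 - t) ^ (r - 1) * t ^ (s - 1) * ((1 - t) ^ N + t ^ N) ^ (-((r:ℝ) + s) / N)) : ℝ) : ℂ))

-- Statement of the registered stub `stub_fermatRealise` (the rule-2 move along `τ = (1−u)^N/Q(u)`).
set_option quotPrecheck false in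
local notation "SigR" =>
  (∀ (N r s : ℕ) (c : ℝ), 1 ≤ N → 1 ≤ r → 1 ≤ s → IsAlgebraic ℚ c →
    ∀ (ρ R : KZ.IntegralRep 1), ρ.domain = {z | z 0 ∈ Set.Ioo (0:ℝ) 1} →
    Set.EqOn ρ.integrand (fun z => c * (z 0) ^ ((r:ℝ) / N - 1) * (1 - z 0) ^ ((s:ℝ) / N - 1)) ρ.domain →
    R.domain = {z | z 0 ∈ Set.Ioo (0:ℝ) 1} →
    (∀ z ∈ R.domain, R.integrand z =
      c * N * ((1 - z 0) ^ (r - 1) * (z 0) ^ (s - 1) * ((1 - z 0) ^ N + (z 0) ^ N) ^ (-((r:ℝ) + s) / N))) →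
    KZ.of ρ - KZ.of R ∈ M₁)

-- Huber–Wüstholz 13.3 (2) restricted to `ℚ̄`-combinations of symbols on affine Fermat curves (the sector apex).
set_option quotPrecheck false in
local notation "HWFermat" =>
  (∀ C : PeriodSymbol →₀ ℂ, (∀ σ, IsAlgebraic ℚ (C σ)) →
    (∀ σ ∈ C.support, ∃ N : ℕ, 1 ≤ N ∧ σ.Z = (⟨2, 1, ![X 0 ^ N + X 1 ^ N - 1]⟩ : CurveData)) →
      evalCombination C = 0 →
      ∃ (k : ℕ) (ρ : Fin k → (PeriodSymbol →₀ ℂ)) (a : Fin k → ℂ),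
        (∀ l, IsElementaryRelation (ρ l)) ∧ (∀ l, IsAlgebraic ℚ (a l)) ∧ C = ∑ l, a l • ρ l)

-- Huber–Wüstholz 13.3 (2) restricted FURTHER to `ℚ̄`-combinations of FERMAT BETA-ARC SYMBOLS `(F_N, ω_{r,s}, γ_N)` (Rohrlich's
-- form along the radial arc between the cusps `(1,0)`, `(0,1)`): in print the setting of Wolfart–Wüstholz 1985 (periods, torsion
-- end points) — the weakest sector apex the layer needs.
set_option quotPrecheck false in
local notation "HWFermatArcs" =>
  (∀ C : PeriodSymbol →₀ ℂ, (∀ σ, IsAlgebraic ℚ (C σ)) →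
    (∀ σ ∈ C.support, ∃ (N r s : ℕ) (hZ : (⟨2, 1, ![X 0 ^ N + X 1 ^ N - 1]⟩ : CurveData).IsSmoothAffineCurve)
        (γ : CurvePath (⟨2, 1, ![X 0 ^ N + X 1 ^ N - 1]⟩ : CurveData))
        (hω : ∀ i, HasAlgCoeffs ((![X 0 ^ (r - 1) * X 1 ^ s, -(X 0 ^ r * X 1 ^ (s - 1))] :
          Fin 2 → MvPolynomial (Fin 2) ℂ) i)),
        1 ≤ N ∧ 1 ≤ r ∧ 1 ≤ s ∧
        (∀ t : ℝ, γ.toFun t = ![(((1 - t) * ((1 - t) ^ N + t ^ N) ^ (-(1:ℝ) / N) : ℝ) : ℂ),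
          ((t * ((1 - t) ^ N + t ^ N) ^ (-(1:ℝ) / N) : ℝ) : ℂ)]) ∧
        σ = ⟨(⟨2, 1, ![X 0 ^ N + X 1 ^ N - 1]⟩ : CurveData), hZ,
          (![X 0 ^ (r - 1) * X 1 ^ s, -(X 0 ^ r * X 1 ^ (s - 1))] : Fin 2 → MvPolynomial (Fin 2) ℂ), hω, γ⟩) →
      evalCombination C = 0 →
      ∃ (k : ℕ) (ρ : Fin k → (PeriodSymbol →₀ ℂ)) (a : Fin k → ℂ),
        (∀ l, IsElementaryRelation (ρ l)) ∧ (∀ l, IsAlgebraic ℚ (a l)) ∧ C = ∑ l, a l • ρ l)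

-- The predicate "is a Fermat beta-arc symbol" (the support condition of `HWFermatArcs`).
set_option quotPrecheck false in
local notation "IsBetaArcSymbol" =>
  (fun σ : PeriodSymbol => ∃ (N r s : ℕ) (hZ : (⟨2, 1, ![X 0 ^ N + X 1 ^ N - 1]⟩ : CurveData).IsSmoothAffineCurve)
        (γ : CurvePath (⟨2, 1, ![X 0 ^ N + X 1 ^ N - 1]⟩ : CurveData))
        (hω : ∀ i, HasAlgCoeffs ((![X 0 ^ (r - 1) * X 1 ^ s, -(X 0 ^ r * X 1 ^ (s - 1))] :
          Fin 2 → MvPolynomial (Fin 2) ℂ) i)),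
        1 ≤ N ∧ 1 ≤ r ∧ 1 ≤ s ∧
        (∀ t : ℝ, γ.toFun t = ![(((1 - t) * ((1 - t) ^ N + t ^ N) ^ (-(1:ℝ) / N) : ℝ) : ℂ),
          ((t * ((1 - t) ^ N + t ^ N) ^ (-(1:ℝ) / N) : ℝ) : ℂ)]) ∧
        σ = ⟨(⟨2, 1, ![X 0 ^ N + X 1 ^ N - 1]⟩ : CurveData), hZ,
          (![X 0 ^ (r - 1) * X 1 ^ s, -(X 0 ^ r * X 1 ^ (s - 1))] : Fin 2 → MvPolynomial (Fin 2) ℂ), hω, γ⟩)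

-- The set of BETA CELLS: one-dimensional representations pinned on `(0,1)` as `c·t^{a-1}(1-t)^{b-1}` (`a, b` positive
-- rationals, `c` real algebraic) — written inline.
set_option quotPrecheck false in
local notation "BetaCellSet" =>
  {ρ : KZ.IntegralRep 1 | ∃ (a b : ℚ) (c : ℝ), 0 < a ∧ 0 < b ∧ IsAlgebraic ℚ c ∧ ρ.domain = {x | x 0 ∈ Set.Ioo (0:ℝ) 1} ∧
    Set.EqOn ρ.integrand (fun x => c * (x 0) ^ ((a:ℝ) - 1) * (1 - x 0) ^ ((b:ℝ) - 1)) ρ.domain}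

/-- CELLS of the layer (bookkeeping): every `c` in the closure of the formal classes of beta cells is, modulo `M₁` (indeed
exactly), a `ℤ`-combination of beta cells. [cite: KontsevichZagier2001, §1.2] -/
theorem betaCells : ∀ c : KZ.FormalRep, c ∈ AddSubgroup.closure ((fun ρ : KZ.IntegralRep 1 => KZ.of ρ) '' BetaCellSet) →
    ∃ N : KZ.IntegralRep 1 →₀ ℤ, (∀ ρ ∈ N.support, ρ ∈ BetaCellSet) ∧ c - N.sum (fun ρ m => m • KZ.of ρ) ∈ M₁ := by
  classical
  intro c hc
  refine AddSubgroup.closure_induction (p := fun c _ => ∃ N : KZ.IntegralRep 1 →₀ ℤ,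
      (∀ ρ ∈ N.support, ρ ∈ BetaCellSet) ∧ c - N.sum (fun ρ m => m • KZ.of ρ) ∈ M₁) ?_ ?_ ?_ ?_ hc
  · rintro _ ⟨r, hr, rfl⟩
    refine ⟨Finsupp.single r 1, fun ρ hρ => ?_, ?_⟩
    · rw [Finsupp.support_single _ one_ne_zero, Finset.mem_singleton] at hρ
      subst hρ
      exact hr
    · rw [Cells.combo_single, sub_self]
      exact M₁.zero_mem
  · exact ⟨0, by simp, by simp [M₁.zero_mem]⟩
  · rintro c c' _ _ ⟨N, hN, hcN⟩ ⟨N', hN', hcN'⟩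
    refine ⟨N + N', fun ρ hρ => ?_, ?_⟩
    · rcases Finset.mem_union.mp (Finsupp.support_add hρ) with h | h
      · exact hN ρ h
      · exact hN' ρ h
    · rw [Cells.combo_add]
      convert M₁.add_mem hcN hcN' using 1
      abel
  · rintro c _ ⟨N, hN, hcN⟩
    refine ⟨-N, fun ρ hρ => hN ρ (by simpa [Finsupp.support_neg] using hρ), ?_⟩
    rw [Cells.combo_neg]
    convert M₁.neg_mem hcN using 1
    abel

/-- ARCS of the layer from the three Fermat stubs (the `harcs` hypothesis of `SectorGlue.realOnePeriodRelations_of_sector` for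
beta cells and Fermat symbols; pattern `EllipticLayer.ellArcs`): a beta cell `[c·t^{a-1}(1-t)^{b-1}]`, `a = r/N`, `b = s/N`, is
modulo `M₁` the real realisation (`stub_realises`) of the ONE symbol `(F_N, ω_{r,s}, γ_N)` with coefficient `−cN`, and has the same
value; the degenerate cell `c = 0` is the empty combination. [cite: HuberWustholz2022, §3.3.1] [cite: Gross1978, §1] -/
theorem betaArcs_of (hD : SigD) (hI : SigI) (hR : SigR) : ∀ ρ : KZ.IntegralRep 1, ρ ∈ BetaCellSet →
    ∃ (C : PeriodSymbol →₀ ℂ) (R : PeriodSymbol → KZ.IntegralRep 1), (∀ σ, IsAlgebraic ℚ (C σ)) ∧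
      (∀ σ ∈ C.support, IsBetaArcSymbol σ) ∧
      (∀ σ ∈ C.support, IsSemialgebraicMapOn ℚ {z : Fin 1 → ℝ | z 0 ∈ Set.Icc (0 : ℝ) 1}
        (fun z => Fin.append (fun i => (σ.γ.toFun (z 0) i).re) (fun i => (σ.γ.toFun (z 0) i).im))) ∧
      (∀ σ ∈ C.support, (R σ).domain = {z | z 0 ∈ Set.Ioo (0 : ℝ) 1} ∧ ∀ z ∈ (R σ).domain, (R σ).integrand z =
        (C σ * ∑ i, MvPolynomial.eval (σ.γ.toFun (z 0)) (σ.ω i) * deriv (fun u => σ.γ.toFun u i) (z 0)).re) ∧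
      evalCombination C = ((ρ.value : ℝ) : ℂ) ∧ KZ.of ρ - ∑ σ ∈ C.support, KZ.of (R σ) ∈ M₁ := by
  classical
  rintro ρ ⟨a, b, c, ha, hb, hc, hdom, hint⟩
  -- set integrals over the unit-interval domain are interval integrals
  have value_of_unitCell : ∀ (ρ : KZ.IntegralRep 1), ρ.domain = {z | z 0 ∈ Set.Ioo (0 : ℝ) 1} →
      ρ.value = ∫ t in (0 : ℝ)..1, ρ.integrand (fun _ => t) := by
    intro ρ hdom
    rw [KZ.IntegralRep.value, hdom]
    have h := Summit.KontsevichZagierPeriods.SymplecticScissors.RealOnePeriodRelationsNegative.setIntegral_unitDom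
      (fun t => ρ.integrand (fun _ => t))
    rw [← h]
    refine setIntegral_congr_fun
      Summit.KontsevichZagierPeriods.SymplecticScissors.RealOnePeriodRelationsNegative.measurableSet_unitDom
      (fun z _ => ?_)
    show ρ.integrand z = ρ.integrand (fun _ => z 0)
    congr 1
    exact KZ.eq_const_apply_zero z
  -- the degenerate cell `c = 0`: the empty combination
  by_cases hc0 : c = 0
  · have hρ0 : ∀ z ∈ ρ.domain, ρ.integrand z = 0 := fun z hz => by rw [hint hz, hc0]; simp
    have hM : KZ.of ρ ∈ M₁ := by
      have h1b : KZ.of ρ - KZ.of ρ - KZ.of ρ ∈ M₁ :=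
        AddSubgroup.subset_closure (Or.inl (Or.inl (Or.inr ⟨1, ρ, ρ, ρ, rfl, rfl,
          fun z hz => by simp [Pi.add_apply, hρ0 z hz], rfl⟩)))
      have : KZ.of ρ = -(KZ.of ρ - KZ.of ρ - KZ.of ρ) := by abel
      rw [this]
      exact M₁.neg_mem h1b
    have hval : ρ.value = 0 := by
      rw [KZ.IntegralRep.value]
      exact setIntegral_eq_zero_of_forall_eq_zero hρ0
    refine ⟨0, fun _ => ρ, fun _ => by simpa using isAlgebraic_zero, by simp, by simp, by simp, ?_, ?_⟩
    · simp [evalCombination, hval]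
    · simpa using hM
  -- level `N` and numerators: `a = r/N`, `b = s/N`
  obtain ⟨N, r, s, hN, hr, hs, haN, hbN⟩ : ∃ N r s : ℕ, 1 ≤ N ∧ 1 ≤ r ∧ 1 ≤ s ∧
      (a : ℝ) = (r : ℝ) / N ∧ (b : ℝ) = (s : ℝ) / N := by
    refine ⟨a.den * b.den, a.num.toNat * b.den, b.num.toNat * a.den, Nat.one_le_iff_ne_zero.2
      (Nat.mul_ne_zero a.den_nz b.den_nz), ?_, ?_, ?_, ?_⟩
    · exact Nat.one_le_iff_ne_zero.2 (Nat.mul_ne_zero (by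
        have := Rat.num_pos.2 ha; omega) b.den_nz)
    · exact Nat.one_le_iff_ne_zero.2 (Nat.mul_ne_zero (by
        have := Rat.num_pos.2 hb; omega) a.den_nz)
    · have hnum : ((a.num.toNat : ℕ) : ℝ) = (a.num : ℝ) := by
        have h0 : 0 ≤ a.num := (Rat.num_pos.2 ha).le
        exact_mod_cast Int.toNat_of_nonneg h0
      have hq : (a : ℝ) = (a.num : ℝ) / (a.den : ℝ) := by exact_mod_cast (Rat.num_div_den a).symm
      rw [hq]
      push_cast
      rw [hnum]
      have hb0 : (b.den : ℝ) ≠ 0 := by exact_mod_cast b.den_nz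
      have ha0 : (a.den : ℝ) ≠ 0 := by exact_mod_cast a.den_nz
      field_simp
    · have hnum : ((b.num.toNat : ℕ) : ℝ) = (b.num : ℝ) := by
        have h0 : 0 ≤ b.num := (Rat.num_pos.2 hb).le
        exact_mod_cast Int.toNat_of_nonneg h0
      have hq : (b : ℝ) = (b.num : ℝ) / (b.den : ℝ) := by exact_mod_cast (Rat.num_div_den b).symm
      rw [hq]
      push_cast
      rw [hnum]
      have hb0 : (b.den : ℝ) ≠ 0 := by exact_mod_cast b.den_nz
      have ha0 : (a.den : ℝ) ≠ 0 := by exact_mod_cast a.den_nz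
      field_simp
  -- symbol data
  obtain ⟨hZ, γ, hγ, hSA⟩ := hD N hN
  set ω : Fin 2 → MvPolynomial (Fin 2) ℂ := ![X 0 ^ (r - 1) * X 1 ^ s, -(X 0 ^ r * X 1 ^ (s - 1))] with hωdef
  have hω : ∀ i, HasAlgCoeffs (ω i) := by
    intro i
    fin_cases i
    · exact ((hasAlgCoeffs_X 0).pow (r - 1)).mul ((hasAlgCoeffs_X 1).pow s)
    · exact (((hasAlgCoeffs_X 0).pow r).mul ((hasAlgCoeffs_X 1).pow (s - 1))).neg
  set sy : PeriodSymbol := ⟨(⟨2, 1, ![X 0 ^ N + X 1 ^ N - 1]⟩ : CurveData), hZ, ω, hω, γ⟩ with hsy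
  -- the coefficient `κ = −cN`
  set κ : ℂ := ((-(c * N) : ℝ) : ℂ) with hκdef
  have hκ : IsAlgebraic ℚ κ := (hc.mul (isAlgebraic_nat N)).neg.algebraMap
  have hκ0 : κ ≠ 0 := by
    rw [hκdef, Ne, Complex.ofReal_eq_zero, neg_eq_zero, mul_eq_zero, not_or]
    exact ⟨hc0, by exact_mod_cast (Nat.one_le_iff_ne_zero.1 hN)⟩
  obtain ⟨R₁, hR₁dom, hR₁⟩ := stub_realises sy.Z sy.γ hSA sy.ω sy.ω_algebraic κ hκ
  -- the realisation integrand on `(0,1)`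
  have hRint : ∀ t ∈ Set.Ioo (0 : ℝ) 1,
      (∑ i, MvPolynomial.eval (sy.γ.toFun t) (sy.ω i) * deriv (fun u => sy.γ.toFun u i) t) =
        ((-((1 - t) ^ (r - 1) * t ^ (s - 1) * ((1 - t) ^ N + t ^ N) ^ (-((r:ℝ) + s) / N)) : ℝ) : ℂ) :=
    fun t ht => hI N r s hN hr hs γ hγ t ht
  have hR₁' : ∀ z ∈ R₁.domain, R₁.integrand z =
      c * N * ((1 - z 0) ^ (r - 1) * (z 0) ^ (s - 1) * ((1 - z 0) ^ N + (z 0) ^ N) ^ (-((r:ℝ) + s) / N)) := by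
    intro z hz
    have ht : z 0 ∈ Set.Ioo (0 : ℝ) 1 := by rw [hR₁dom] at hz; exact hz
    rw [hR₁ z hz, hRint (z 0) ht, hκdef, ← Complex.ofReal_mul, Complex.ofReal_re]
    ring
  -- rule 2: `[ρ] − [R₁] ∈ M₁`
  have hsub : KZ.of ρ - KZ.of R₁ ∈ M₁ := by
    refine hR N r s c hN hr hs hc ρ R₁ hdom (fun z hz => ?_) hR₁dom hR₁'
    rw [hint hz, haN, hbN]
  have hval : R₁.value = ρ.value := by
    have h := Summit.KontsevichZagierPeriods.SymplecticScissors.RealOnePeriodRelationsNegative.eval_eq_zero_of_mem_M₁ hsub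
    rw [map_sub, KZ.eval_of, KZ.eval_of, sub_eq_zero] at h
    exact h.symm
  refine ⟨Finsupp.single sy κ, fun _ => R₁, ?_, ?_, ?_, ?_, ?_, ?_⟩
  · intro t
    by_cases h : t = sy
    · subst h; simpa using hκ
    · rw [Finsupp.single_apply, if_neg (Ne.symm h)]; exact isAlgebraic_zero
  · intro t ht
    rw [Finsupp.support_single _ hκ0, Finset.mem_singleton] at ht
    subst ht
    exact ⟨N, r, s, hZ, γ, hω, hN, hr, hs, hγ, rfl⟩
  · intro t ht
    rw [Finsupp.support_single _ hκ0, Finset.mem_singleton] at ht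
    subst ht
    exact hSA
  · intro t ht
    rw [Finsupp.support_single _ hκ0, Finset.mem_singleton] at ht
    subst ht
    refine ⟨hR₁dom, fun z hz => ?_⟩
    rw [hR₁ z hz, Finsupp.single_eq_same]
  · -- the value: `κ · period sy = R₁.value = ρ.value`
    rw [evalCombination, Finsupp.sum_single_index (by simp), PeriodSymbol.period, ← hval,
      value_of_unitCell R₁ hR₁dom, ← intervalIntegral.integral_ofReal, ← intervalIntegral.integral_const_mul,
      intervalIntegral.integral_of_le zero_le_one, intervalIntegral.integral_of_le zero_le_one,
      integral_Ioc_eq_integral_Ioo, integral_Ioc_eq_integral_Ioo]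
    refine setIntegral_congr_fun measurableSet_Ioo fun t ht => ?_
    have hz : (fun _ : Fin 1 => t) ∈ R₁.domain := by rw [hR₁dom]; exact ht
    rw [hR₁ _ hz]
    show κ * (∑ i, MvPolynomial.eval (sy.γ.toFun t) (sy.ω i) * deriv (fun u => sy.γ.toFun u i) t) = _
    rw [hRint t ht, hκdef, ← Complex.ofReal_mul, Complex.ofReal_re]
  · rw [Finsupp.support_single _ hκ0, Finset.sum_singleton]
    exact hsub

/-- **THE FERMAT LAYER** (implication-shaped): from the three Fermat stubs and Huber–Wüstholz 13.3 (2) on Fermat BETA-ARC symbols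
(`HWFermatArcs`, the Wolfart–Wüstholz setting), every
`ℤ`-combination of beta cells with vanishing value lies in `M₁ = closure (1a ∪ 1b ∪ 2 ∪ Green)` — the landed sector glue
`SectorGlue.realOnePeriodRelations_of_sector` fed with `betaCells` and `betaArcs_of`. [cite: HuberWustholz2022, Thm 13.3 (2)] -/
theorem fermatLayer_of (hD : SigD) (hI : SigI) (hR : SigR) (hHW : HWFermatArcs) :
    ∀ c : KZ.FormalRep, c ∈ AddSubgroup.closure ((fun ρ : KZ.IntegralRep 1 => KZ.of ρ) '' BetaCellSet) →
      KZ.eval c = 0 → c ∈ M₁ :=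
  Summit.KontsevichZagierPeriods.SymplecticScissors.RealOnePeriodRelations.SectorGlue.realOnePeriodRelations_of_sector
    ((fun ρ : KZ.IntegralRep 1 => KZ.of ρ) '' BetaCellSet) (· ∈ BetaCellSet) IsBetaArcSymbol hHW betaCells
    (betaArcs_of hD hI hR)

/-- The named fact `HuberWustholzCurvePeriods` (HW 13.3 (2) for all curve-type symbols) implies its restriction to Fermat symbols
(strict weakening). [cite: HuberWustholz2022, Thm 13.3 (2)] -/
theorem huberWustholzFermat_of_huberWustholzCurvePeriods (h : HuberWustholzCurvePeriods) : HWFermat :=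
  fun C hC _ h0 => h C hC h0

/-- HW 13.3 (2) on all symbols of affine Fermat curves implies it on Fermat beta-arc symbols (a beta-arc symbol lives on some
`F_N`, `N ≥ 1`). [cite: HuberWustholz2022, Thm 13.3 (2)] -/
theorem huberWustholzFermatArcs_of_huberWustholzFermat (h : HWFermat) : HWFermatArcs := by
  intro C hC hsupp h0
  refine h C hC (fun σ hσ => ?_) h0
  obtain ⟨N, r, s, hZ, γ, hω, hN, -, -, -, rfl⟩ := hsupp σ hσ
  exact ⟨N, hN, rfl⟩

/-- The named fact `HuberWustholzCurvePeriods` implies HW 13.3 (2) on Fermat beta-arc symbols. [cite: HuberWustholz2022, Thm 13.3 (2)] -/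
theorem huberWustholzFermatArcs_of_huberWustholzCurvePeriods (h : HuberWustholzCurvePeriods) : HWFermatArcs :=
  fun C hC _ h0 => h C hC h0

/-- The crux from the Fermat layer and Green: the two hypothesis representations are beta cells (`c = 1` on the left),
`[r] − [r']` lies in the closure of the beta classes and has value `0`, so it lies in `M₁` by the layer, and `M₁ ≤ relations` by
Green (`M₁_le_relations_of_green`). CONDITIONAL on both hypotheses. [cite: HuberWustholz2022, Thm 13.3 (2)] [cite: KontsevichZagier2001, §1.2] -/
theorem betaLinearSector_of_fermatLayer
    (hL : ∀ c : KZ.FormalRep, c ∈ AddSubgroup.closure ((fun ρ : KZ.IntegralRep 1 => KZ.of ρ) '' BetaCellSet) →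
      KZ.eval c = 0 → c ∈ M₁)
    (hG : ∀ g ∈ Summit.KontsevichZagierPeriods.SymplecticScissors.RealOnePeriodRelationsNegative.greenSet,
      g ∈ Literature.NumberTheory.Transcendental.KZ.relations) :
    Summit.KontsevichZagierPeriods.KontsevichZagierPeriods.Theses.FermatIsogeny.BetaLinearSector := by
  intro a b a' b' c ha hb ha' hb' hc r r' hd hi hd' hi' hv
  have hr : r ∈ BetaCellSet := by
    refine ⟨a, b, 1, ha, hb, isAlgebraic_one, hd, fun x hx => ?_⟩
    rw [hi hx]
    simp only [one_mul]
  have hr' : r' ∈ BetaCellSet := ⟨a', b', c, ha', hb', hc, hd', hi'⟩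
  have hmem : KZ.of r - KZ.of r' ∈ AddSubgroup.closure ((fun ρ : KZ.IntegralRep 1 => KZ.of ρ) '' BetaCellSet) :=
    AddSubgroup.sub_mem _ (AddSubgroup.subset_closure ⟨r, hr, rfl⟩) (AddSubgroup.subset_closure ⟨r', hr', rfl⟩)
  have heval : KZ.eval (KZ.of r - KZ.of r') = 0 := by
    rw [map_sub, KZ.eval_of, KZ.eval_of, hv, sub_self]
  exact M₁_le_relations_of_green hG (hL _ hmem heval)

/-- **The crux from the five registered inputs of line `fermat-sector-transport`** (registered anchor
`BetaLinearSector_of_fermatStubs`): symbol data, arc integrand, rule-2 realisation, the named fact `HuberWustholzCurvePeriods`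
and Green imply `BetaLinearSector`. CONDITIONAL (credits nothing by itself); each hypothesis is discharged by name as the
corresponding stub lands. [cite: HuberWustholz2022, Thm 13.3 (2)] -/
theorem BetaLinearSector_of_fermatStubs :
    (∀ N : ℕ, 1 ≤ N → (⟨2, 1, ![X 0 ^ N + X 1 ^ N - 1]⟩ : CurveData).IsSmoothAffineCurve ∧ ∃ γ : CurvePath (⟨2, 1, ![X
    0 ^ N + X 1 ^ N - 1]⟩ : CurveData), (∀ t : ℝ, γ.toFun t = ![(((1 - t) * ((1 - t) ^ N + t ^ N) ^ (-(1:ℝ) / N) : ℝ)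
    : ℂ), ((t * ((1 - t) ^ N + t ^ N) ^ (-(1:ℝ) / N) : ℝ) : ℂ)]) ∧ IsSemialgebraicMapOn ℚ {z : Fin 1 → ℝ | z 0 ∈
    Set.Icc (0 : ℝ) 1} (fun z => Fin.append (fun i => (γ.toFun (z 0) i).re) (fun i => (γ.toFun (z 0) i).im))) → (∀ (N
    r s : ℕ), 1 ≤ N → 1 ≤ r → 1 ≤ s → ∀ γ : CurvePath (⟨2, 1, ![X 0 ^ N + X 1 ^ N - 1]⟩ : CurveData), (∀ t : ℝ,
    γ.toFun t = ![(((1 - t) * ((1 - t) ^ N + t ^ N) ^ (-(1:ℝ) / N) : ℝ) : ℂ), ((t * ((1 - t) ^ N + t ^ N) ^ (-(1:ℝ) /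
    N) : ℝ) : ℂ)]) → ∀ t ∈ Set.Ioo (0:ℝ) 1, (∑ i, MvPolynomial.eval (γ.toFun t) ((![X 0 ^ (r - 1) * X 1 ^ s, -(X 0 ^ r
    * X 1 ^ (s - 1))] : Fin 2 → MvPolynomial (Fin 2) ℂ) i) * deriv (fun u => γ.toFun u i) t) = ((-((1 - t) ^ (r - 1) *
    t ^ (s - 1) * ((1 - t) ^ N + t ^ N) ^ (-((r:ℝ) + s) / N)) : ℝ) : ℂ)) → (∀ (N r s : ℕ) (c : ℝ), 1 ≤ N → 1 ≤ r → 1 ≤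
    s → IsAlgebraic ℚ c → ∀ (ρ R : KZ.IntegralRep 1), ρ.domain = {z | z 0 ∈ Set.Ioo (0:ℝ) 1} → Set.EqOn ρ.integrand
    (fun z => c * (z 0) ^ ((r:ℝ) / N - 1) * (1 - z 0) ^ ((s:ℝ) / N - 1)) ρ.domain → R.domain = {z | z 0 ∈ Set.Ioo
    (0:ℝ) 1} → (∀ z ∈ R.domain, R.integrand z = c * N * ((1 - z 0) ^ (r - 1) * (z 0) ^ (s - 1) * ((1 - z 0) ^ N + (z
    0) ^ N) ^ (-((r:ℝ) + s) / N))) → KZ.of ρ - KZ.of R ∈ M₁) →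
    Literature.NumberTheory.Transcendental.HuberWustholzCurvePeriods → (∀ g ∈
    Summit.KontsevichZagierPeriods.SymplecticScissors.RealOnePeriodRelationsNegative.greenSet, g ∈
    Literature.NumberTheory.Transcendental.KZ.relations) →
    Summit.KontsevichZagierPeriods.KontsevichZagierPeriods.Theses.FermatIsogeny.BetaLinearSector :=
  fun hD hI hR hHW hG =>
    betaLinearSector_of_fermatLayer (fermatLayer_of hD hI hR (huberWustholzFermatArcs_of_huberWustholzCurvePeriods hHW)) hG

end Summit.KontsevichZagierPeriods.FermatIsogeny.BetaLinearSector

end
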